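import Literature.NumberTheory.GaloisRepresentations.AlgebraicHeckeCharacterGrossencharakterProofs
import Literature.NumberTheory.Automorphic.UnitaryInfinityType
import HarnessLib

/-!
# The infinity type of a Hecke character is unique (at complex places; `p + q` at real places)

Topic `NumberTheory/GaloisRepresentations`; namespace `Literature.NumberTheory.GaloisRepresentations`.
A *proofs* file (theorems only; no definition, no named fact, no instance).

In the tree's convention an algebraic Hecke character `χ` of a number field `K` **has infinity type
`(p, q)`** (`HeckeCharacter.HasInfinityType χ p q`, after Weil 1956 §1 / Serre 1968 II §2.4) when
`χ((x, 1)) = A_{p,q}(x) := ∏_{w ∣ ∞} ι_w(x_w)^{-p_w} \overline{ι_w(x_w)}^{-q_w}` on a neighbourhood of `1` in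
`(K ⊗ ℝ)ˣ`.  This file proves that the type is DETERMINED by `χ`:

* `HeckeCharacter.HasInfinityType.eq_of_isComplex` — at a complex place `w`, two types of the same `χ`
  have `p_w = p′_w` and `q_w = q′_w`;
* `HeckeCharacter.HasInfinityType.add_eq_add` — at every place, `p_w + q_w = p′_w + q′_w` (at a real
  place only `p_w + q_w` is meaningful, `ι_w = \bar ι_w`);
* `HeckeCharacter.HasInfinityType.eq_of_isTotallyComplex` — on a totally complex field, `p = p′` and
  `q = q′`.

PROOF.  By `HasInfinityType.apply_infiniteIdeles_eq` (Weil 1956 §1; Neukirch VII (6.9)) the type governs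
`χ` on ALL totally positive infinite ideles, so `A_{p,q} = A_{p′,q′}` there
(`archFactor_eq_of_isTotallyPositive`).  Test on the ideles concentrated at one place `w`
(`Literature.NumberTheory.Automorphic.InfiniteAdeleRing.singleUnits`, `archFactor_singleUnits`): with
coordinate `2` one gets `2^{-(p_w+q_w)} = 2^{-(p′_w+q′_w)}`; at a complex `w`, with a coordinate `ζ` of
absolute value `1` and `ζ^d ≠ 1` for `d = (p_w − q_w) − (p′_w − q′_w) ≠ 0`
(`Literature.Analysis.Complex.exists_norm_eq_one_zpow_ne_one`, `\bar ζ = ζ⁻¹`) one gets a contradiction,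
so `p_w − q_w = p′_w − q′_w`.  (Weil, *Basic Number Theory* VII §3, for the unitary normalisation; the
unitary twin is `Automorphic.IdeleClassGroup.infinityType_unique_of_isComplex`.)

Consumer: step 4 of the d6 line card (`Cruxes/HLiu418/Lines/d6_cm_curve`, [Liu2021 Thm. D.6 (1)] proof
l. 5625–5630: «`μ₁μ₂⁻¹` is not a Dirichlet character», `μ̃_{τ₁}(z) = 1/z` vs `1/z̄`) — excluding
`ψ_lab = μ₂` from two different types of one character at the place of `τ₁`.

## References
* A. Weil, *On a certain type of characters of the idèle-class group of an algebraic number-field* (1956), §1. [Weil1956]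
* A. Weil, *Basic Number Theory* (1967), Ch. VII §3. [WeilBNT1967]
* J.-P. Serre, *Abelian ℓ-adic representations and elliptic curves* (1968), Ch. II §2.4. [SerreAbelianLadic1968]
* Y. Liu, *Fourier–Jacobi cycles and arithmetic relative trace formula* (2021), App. D §D.4 (l. 5625–5630). [Liu2021]
-/

noncomputable section

open scoped NumberField ComplexConjugate
open NumberField NumberField.InfinitePlace NumberField.InfinitePlace.Completion
open Literature.NumberTheory.Automorphic Literature.NumberTheory.Automorphic.InfiniteAdeleRing

namespace Literature.NumberTheory.GaloisRepresentations

namespace HeckeCharacter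

variable {K : Type} [Field K] [NumberField K]

/-! ### The archimedean factor on one-place ideles -/

/-- **`A_{p,q}` at an idele concentrated at one place**: for `c ∈ K_wˣ` placed at `w` (and `1` elsewhere),
`A_{p,q}((c)_w) = ι_w(c)^{-p_w} \overline{ι_w(c)}^{-q_w}`. [cite: Weil1956, §1] -/
theorem archFactor_singleUnits (p q : InfinitePlace K → ℤ) (w : InfinitePlace K) (c : (w.Completion)ˣ) :
    archFactor p q (singleUnits K w c) =
      extensionEmbedding w (c : w.Completion) ^ (-p w) * conj (extensionEmbedding w (c : w.Completion)) ^ (-q w) := by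
  classical
  rw [archFactor_apply, Finset.prod_eq_single w]
  · rw [singleUnits_apply_self]
  · intro v _ hv
    rw [singleUnits_apply_of_ne K w c hv, map_one, map_one, one_zpow, one_zpow, mul_one]
  · intro h
    exact absurd (Finset.mem_univ w) h

omit [NumberField K] in
/-- An idele concentrated at a COMPLEX place is totally positive (its real coordinates are `1`).
[cite: Weil1956, §1] -/
theorem isTotallyPositive_singleUnits_of_isComplex {w : InfinitePlace K} (hw : w.IsComplex)
    (c : (w.Completion)ˣ) : InfiniteIdele.IsTotallyPositive (singleUnits K w c) := by
  intro v hv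
  have hvw : v ≠ w := fun h => (not_isReal_iff_isComplex.mpr hw) (h ▸ hv)
  rw [singleUnits_apply_of_ne K w c hvw, map_one]
  exact one_pos

omit [NumberField K] in
/-- An idele concentrated at a REAL place with positive coordinate is totally positive. [cite: Weil1956, §1] -/
theorem isTotallyPositive_singleUnits_of_pos {w : InfinitePlace K} (hw : w.IsReal) {c : (w.Completion)ˣ}
    (hc : 0 < extensionEmbeddingOfIsReal hw (c : w.Completion)) :
    InfiniteIdele.IsTotallyPositive (singleUnits K w c) := by
  intro v hv
  by_cases hvw : v = w
  · subst hvw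
    rw [singleUnits_apply_self]
    exact hc
  · rw [singleUnits_apply_of_ne K w c hvw, map_one]
    exact one_pos

/-! ### Two types of one character -/

/-- **Two infinity types of the same character give the same archimedean factor on totally positive
ideles** (`HasInfinityType.apply_infiniteIdeles_eq` twice). [cite: Weil1956, §1] [cite: NeukirchANT1999, Ch. VII §6 Prop. (6.9)] -/
theorem HasInfinityType.archFactor_eq_of_isTotallyPositive {χ : HeckeCharacter K}
    {p q p' q' : InfinitePlace K → ℤ} (h : χ.HasInfinityType p q) (h' : χ.HasInfinityType p' q')
    {x : (InfiniteAdeleRing K)ˣ} (hx : InfiniteIdele.IsTotallyPositive x) :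
    archFactor p q x = archFactor p' q' x := by
  rw [← h.apply_infiniteIdeles_eq hx, ← h'.apply_infiniteIdeles_eq hx]

/-- **`p_w + q_w` is determined at every place**: test the idele `(2)_w`, where
`A_{p,q}((2)_w) = 2^{-(p_w + q_w)}`. [cite: Weil1956, §1] [cite: WeilBNT1967, Ch. VII §3] -/
theorem HasInfinityType.add_eq_add {χ : HeckeCharacter K} {p q p' q' : InfinitePlace K → ℤ}
    (h : χ.HasInfinityType p q) (h' : χ.HasInfinityType p' q') (w : InfinitePlace K) :
    p w + q w = p' w + q' w := by
  -- a coordinate `c ∈ K_w` with `ι_w(c) = 2`, positive at `w` if `w` is real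
  obtain ⟨c, hc2, hpos⟩ : ∃ c : w.Completion, extensionEmbedding w c = 2 ∧
      ∀ hw : w.IsReal, 0 < extensionEmbeddingOfIsReal hw c := by
    by_cases hw : w.IsReal
    · obtain ⟨c, hc⟩ := surjective_extensionEmbeddingOfIsReal hw 2
      refine ⟨c, ?_, fun hw' => ?_⟩
      · rw [← extensionEmbeddingOfIsReal_apply hw, hc]; norm_num
      · rw [hc]; exact two_pos
    · obtain ⟨c, hc⟩ := surjective_extensionEmbedding_of_isComplex (not_isReal_iff_isComplex.mp hw) 2
      exact ⟨c, hc, fun hw' => absurd hw' hw⟩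
  have hc0 : c ≠ 0 := fun h0 => by rw [h0, map_zero] at hc2; norm_num at hc2
  let cu : (w.Completion)ˣ := Units.mk0 c hc0
  have htp : InfiniteIdele.IsTotallyPositive (singleUnits K w cu) := by
    by_cases hw : w.IsReal
    · exact isTotallyPositive_singleUnits_of_pos hw (hpos hw)
    · exact isTotallyPositive_singleUnits_of_isComplex (not_isReal_iff_isComplex.mp hw) cu
  have key := h.archFactor_eq_of_isTotallyPositive h' htp
  rw [archFactor_singleUnits, archFactor_singleUnits] at key
  have hcu : extensionEmbedding w (cu : w.Completion) = 2 := hc2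
  rw [hcu, map_ofNat, ← zpow_add₀ (two_ne_zero' ℂ), ← zpow_add₀ (two_ne_zero' ℂ)] at key
  -- `2 ^ a = 2 ^ b` in `ℂ` forces `a = b`
  have hn := congrArg (fun z : ℂ => ‖z‖) key
  simp only [norm_zpow, Complex.norm_ofNat] at hn
  have hinj := zpow_right_injective₀ (two_pos : (0 : ℝ) < 2) (by norm_num : (2 : ℝ) ≠ 1) hn
  omega

/-- **`p_w − q_w` is determined at a complex place**: test the idele `(ζ)_w` with `|ζ| = 1`, `ζ^d ≠ 1`
for `d = (p_w − q_w) − (p′_w − q′_w)` (`\bar ζ = ζ⁻¹`, so `A_{p,q}((ζ)_w) = ζ^{q_w − p_w}`).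
[cite: Weil1956, §1] [cite: WeilBNT1967, Ch. VII §3] -/
theorem HasInfinityType.sub_eq_sub_of_isComplex {χ : HeckeCharacter K} {p q p' q' : InfinitePlace K → ℤ}
    (h : χ.HasInfinityType p q) (h' : χ.HasInfinityType p' q') {w : InfinitePlace K} (hw : w.IsComplex) :
    p w - q w = p' w - q' w := by
  by_contra hne
  have hd : (q w - p w) - (q' w - p' w) ≠ 0 := by omega
  obtain ⟨ζ, hζ1, hζd⟩ := Literature.Analysis.Complex.exists_norm_eq_one_zpow_ne_one hd
  have hζ0 : ζ ≠ 0 := fun h0 => by simp [h0] at hζ1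
  obtain ⟨c, hc⟩ := surjective_extensionEmbedding_of_isComplex hw ζ
  have hc0 : c ≠ 0 := fun h0 => hζ0 (by rw [← hc, h0, map_zero])
  let cu : (w.Completion)ˣ := Units.mk0 c hc0
  have key := h.archFactor_eq_of_isTotallyPositive h' (isTotallyPositive_singleUnits_of_isComplex hw cu)
  rw [archFactor_singleUnits, archFactor_singleUnits] at key
  have hcu : extensionEmbedding w (cu : w.Completion) = ζ := hc
  rw [hcu, ← Complex.inv_eq_conj hζ1] at key
  simp only [inv_zpow', neg_neg] at key
  rw [← zpow_add₀ hζ0, ← zpow_add₀ hζ0] at key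
  -- `ζ ^ (q - p) = ζ ^ (q' - p')` ⇒ `ζ ^ d = 1`
  apply hζd
  have : ζ ^ ((q w - p w) - (q' w - p' w)) = ζ ^ (-p w + q w) / ζ ^ (-p' w + q' w) := by
    rw [← zpow_sub₀ hζ0]
    congr 1
    ring
  rw [this, key, div_self (zpow_ne_zero _ hζ0)]

/-- **Uniqueness of the infinity type at a complex place**: `p_w = p′_w` and `q_w = q′_w`.
[cite: Weil1956, §1] [cite: WeilBNT1967, Ch. VII §3] [cite: SerreAbelianLadic1968, Ch. II §2.4] -/
theorem HasInfinityType.eq_of_isComplex {χ : HeckeCharacter K} {p q p' q' : InfinitePlace K → ℤ}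
    (h : χ.HasInfinityType p q) (h' : χ.HasInfinityType p' q') {w : InfinitePlace K} (hw : w.IsComplex) :
    p w = p' w ∧ q w = q' w := by
  have h1 := h.add_eq_add h' w
  have h2 := h.sub_eq_sub_of_isComplex h' hw
  omega

/-- **On a totally complex field the infinity type is unique.** [cite: Weil1956, §1] [cite: WeilBNT1967, Ch. VII §3] -/
theorem HasInfinityType.eq_of_isTotallyComplex [IsTotallyComplex K] {χ : HeckeCharacter K}
    {p q p' q' : InfinitePlace K → ℤ} (h : χ.HasInfinityType p q) (h' : χ.HasInfinityType p' q') :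
    p = p' ∧ q = q' :=
  ⟨funext fun w => (h.eq_of_isComplex h' (IsTotallyComplex.isComplex w)).1,
    funext fun w => (h.eq_of_isComplex h' (IsTotallyComplex.isComplex w)).2⟩

/-- **Two characters with different types at a complex place are different** (the form the d6 step 4
consumes: `ψ` of type `(p, q)` and `μ₂` of type `(p′, q′)` with `(p_w, q_w) ≠ (p′_w, q′_w)` ⇒ `ψ ≠ μ₂`).
[cite: Liu2021, Thm. D.6 (1) proof l. 5625–5630] [cite: Weil1956, §1] -/
theorem ne_of_hasInfinityType_ne_at_isComplex {χ χ' : HeckeCharacter K} {p q p' q' : InfinitePlace K → ℤ}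
    (h : χ.HasInfinityType p q) (h' : χ'.HasInfinityType p' q') {w : InfinitePlace K} (hw : w.IsComplex)
    (hne : p w ≠ p' w ∨ q w ≠ q' w) : χ ≠ χ' := by
  rintro rfl
  obtain ⟨hp, hq⟩ := h.eq_of_isComplex h' hw
  exact hne.elim (fun hp' => hp' hp) (fun hq' => hq' hq)

end HeckeCharacter

end Literature.NumberTheory.GaloisRepresentations

end
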